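import Literature.Computability.QuantumComplexity.ShallowCircuitsRing
import Mathlib.Data.ZMod.Defs
import HarnessLib

/-!
# Cell qa-qnc0 — structure of the ring kernel `K(x)`: transfer maps and the `S₃` monodromy (all `n`)

The ring kernel `K(x) = ker(A_{Cₙ} + diag x)` over `𝔽₂` (tree `RingHLF.InKernel`:
`v_{i−1} + v_{i+1} + x_i v_i = 0`, indices mod `n`) is a TRANSFER-MATRIX object: the state
`s_i = (v_{i−1}, v_i)` evolves by `s_{i+1} = T_{x_i} s_i`, `T_b (p, q) = (q, p + b q)`, and
`v ∈ K(x)` iff `s_0` is a fixed point of the monodromy `W(x) = T_{x_{n−1}} ∘ ⋯ ∘ T_{x_0}`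
(`inKernel_iff_fixed`). The maps `T_0` (order 2) and `T_1` (order 3) generate
`GL₂(𝔽₂) ≅ S₃`; planner qa-qnc0-p2's DICTIONARY THEOREM (`HOME/qa-qnc0-p2/artefacts/RingFrameSketch
.lean`, `Monodromy.W_eq_dict`, proved there for matrices; re-proved here for maps, `monodromy_eq_dict`)
computes `W(x) = dict (reflBit x) (sigmaSum x)` from two scalar statistics of the word: the parity
`reflBit` of the number of `0`s and a signed count `sigmaSum ∈ ℤ/3`. Reading off the fixed points
of the six group elements (`decide`) gives the STRUCTURE THEOREM (all `n ≥ 3`; planner qa-qnc0-p1's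
K6 (F1)/(F2), exhaustive for `n ≤ 12` there):

* `kernel_odd` — if the number of zeros of `x` is odd (transposition class), `K(x) = {0, v⋆(x)}`
  with the explicit nonzero vector `v⋆(x) = kernelVec x (fixVec (sigmaSum x))` (trajectory of the
  unique fixed state);
* `kernel_even_trivial` / `kernel_even_full` — if it is even, `K(x) = {0}` when
  `sigmaSum x ≠ 0` and `K(x)` = all four trajectories when `sigmaSum x = 0`.

Everything is finite-state: one induction (`iter_eq_of_inKernel`) and `decide`-checked tables.

Also `kernelVec_eq_dict_prefix`: `v_k` is the dictionary element of the prefix word applied to the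
initial state (p2's `SuppWalkLaw` in dictionary coordinates).

WHAT THIS IS NOT: the translation of prefix `reflBit`/`sigmaSum` into p2's `uCoord`/`Wk` counts and
the sign bit `ℓ_x(v⋆)` are not computed here.
-/

namespace Summit.QuantumAdvantage.AdviceFreeQNC0

open Literature.Computability.QuantumComplexity Literature.Computability.QuantumComplexity.RingHLF

/-! ### Transfer maps on the state space `𝔽₂²` and the six monodromies -/

/-- The state space `𝔽₂ × 𝔽₂` (states `s_i = (v_{i−1}, v_i)`). -/
abbrev St : Type := Bool × Bool

/-- The transfer map of one vertex with pattern bit `b`: `(v_{i−1}, v_i) ↦ (v_i, v_{i−1} + b·v_i)`. -/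
def tstep (b : Bool) (s : St) : St := (s.2, xor s.1 (b && s.2))

/-- The monodromy of a word (first letter applied first). -/
def monodromy (l : List Bool) (s : St) : St := l.foldl (fun s b => tstep b s) s

/-- Reflection bit: parity of the number of `0`s (= of order-2 generators) in the word
(planner qa-qnc0-p2, `Monodromy.reflBit`). -/
def reflBit : List Bool → Bool
  | [] => false
  | b :: rest => xor (reflBit rest) (!b)

/-- The signed count `Σ_i (−1)^{p_i} ∈ ℤ/3`, `p_i` = parity of the zeros after position `i`
(planner qa-qnc0-p2, `Monodromy.sigmaSum`). -/
def sigmaSum : List Bool → ZMod 3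
  | [] => 0
  | _ :: rest => sigmaSum rest + (if reflBit rest then -1 else 1)

/-- The six elements of `GL₂(𝔽₂) ≅ S₃` as maps, indexed by (reflection bit, `ℤ/3`):
`b = 0`: `1, r, r²`; `b = 1`: the three transpositions (planner qa-qnc0-p2's `dict`, as maps on
column vectors). -/
def dict (b : Bool) (S : ZMod 3) (s : St) : St :=
  if b then
    (if S = 0 then (xor s.1 s.2, s.2) else if S = 1 then (s.2, s.1) else (s.1, xor s.1 s.2))
  else
    (if S = 0 then s else if S = 1 then (s.2, xor s.1 s.2) else (xor s.1 s.2, s.1))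

/-- One-step compatibility of the dictionary (finite check):
`dict rb S ∘ T_b = dict (rb ⊕ ¬b) (S + (−1)^{rb})`. -/
theorem dict_tstep : ∀ (b rb : Bool) (S : ZMod 3) (s : St),
    dict rb S (tstep b s) = dict (xor rb (!b)) (S + (if rb then -1 else 1)) s := by
  decide

/-- **Dictionary theorem** (planner qa-qnc0-p2's `W_eq_dict`, map form, all word lengths):
`W(l) = dict (reflBit l) (sigmaSum l)`. -/
theorem monodromy_eq_dict : ∀ (l : List Bool) (s : St), monodromy l s = dict (reflBit l) (sigmaSum l) s
  | [], s => by simp [monodromy, reflBit, sigmaSum, dict]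
  | b :: rest, s => by
      have ih := monodromy_eq_dict rest (tstep b s)
      simp only [monodromy, List.foldl_cons] at ih ⊢
      rw [ih, dict_tstep, reflBit, sigmaSum]

/-- The fixed state of the transposition `dict true S`: `S = 0 ↦ (1,0)`, `S = 1 ↦ (1,1)`,
`S = 2 ↦ (0,1)`. -/
def fixVec (S : ZMod 3) : St := if S = 0 then (true, false) else if S = 1 then (true, true) else (false, true)

/-- Fixed points of a transposition: exactly `0` and `fixVec S` (finite check). -/
theorem dict_true_fixed_iff : ∀ (S : ZMod 3) (s : St),
    dict true S s = s ↔ (s = (false, false) ∨ s = fixVec S) := by decide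

/-- `fixVec S ≠ 0`. -/
theorem fixVec_ne_zero : ∀ S : ZMod 3, fixVec S ≠ (false, false) := by decide

/-- Fixed points of the rotations: `dict false S` fixes everything if `S = 0` and only `0`
otherwise (finite check). -/
theorem dict_false_fixed_iff : ∀ (S : ZMod 3) (s : St),
    dict false S s = s ↔ (S = 0 ∨ s = (false, false)) := by decide

/-! ### Trajectories on the ring -/

variable {n : ℕ}

/-- The state after `k` steps from the initial state `s`, reading `x_0, …, x_{k−1}`. -/
def iter (x : Fin n → Bool) (k : ℕ) (s : St) : St :=
  ((List.ofFn x).take k).foldl (fun s b => tstep b s) s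

/-- The trajectory vector `v_k = (iter x k s).2` (`k < n`). -/
def kernelVec (x : Fin n → Bool) (s : St) : Fin n → Bool := fun k => (iter x k.val s).2

omit n in
/-- One more letter: folding over `take (k+1)` is one `tstep` after folding over `take k`. -/
private theorem foldl_take_succ {l : List Bool} {k : ℕ} (hk : k < l.length) (s : St) :
    (l.take (k + 1)).foldl (fun s b => tstep b s) s =
      tstep (l.get ⟨k, hk⟩) ((l.take k).foldl (fun s b => tstep b s) s) := by
  rw [List.take_add_one, List.foldl_append]
  simp [List.getElem?_eq_getElem hk]

/-- `iter 0 = id`. -/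
@[simp] theorem iter_zero (x : Fin n → Bool) (s : St) : iter x 0 s = s := by
  simp [iter]

/-- The recursion `iter (k+1) = T_{x_k} ∘ iter k` for `k < n`. -/
theorem iter_succ (x : Fin n → Bool) {k : ℕ} (hk : k < n) (s : St) :
    iter x (k + 1) s = tstep (x ⟨k, hk⟩) (iter x k s) := by
  unfold iter
  rw [foldl_take_succ (by rw [List.length_ofFn]; exact hk)]
  simp

/-- After `n` steps the trajectory has applied the monodromy of the word `x`. -/
theorem iter_length (x : Fin n → Bool) (s : St) : iter x n s = monodromy (List.ofFn x) s := by
  unfold iter monodromy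
  rw [List.take_of_length_le (by rw [List.length_ofFn])]

/-- The first component of the next state is the second of the current one. -/
theorem iter_succ_fst (x : Fin n → Bool) {k : ℕ} (hk : k < n) (s : St) :
    (iter x (k + 1) s).1 = (iter x k s).2 := by
  rw [iter_succ x hk]; rfl

/-- **Kernel vectors are trajectories**: if `v ∈ K(x)` then for every `k ≤ n` the state after
`k` steps from `s_0 = (v_{n−1}, v_0)` is `(v_{k−1}, v_k)` (indices mod `n`). -/
theorem iter_eq_of_inKernel (hn : 3 ≤ n) {x v : Fin n → Bool} (hv : InKernel x v) :
    ∀ k, (hk : k ≤ n) →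
      iter x k (v ⟨n - 1, by omega⟩, v ⟨0, by omega⟩) =
        (v ⟨(k + n - 1) % n, Nat.mod_lt _ (by omega)⟩, v ⟨k % n, Nat.mod_lt _ (by omega)⟩) := by
  intro k
  induction k with
  | zero =>
    intro _
    rw [iter_zero]
    refine Prod.ext ?_ ?_
    · exact congrArg v (Fin.ext (by
        show n - 1 = (0 + n - 1) % n
        rw [Nat.zero_add, Nat.mod_eq_of_lt (show n - 1 < n by omega)]))
    · exact congrArg v (Fin.ext (by
        show 0 = 0 % n
        rw [Nat.zero_mod]))
  | succ k ih =>
    intro hk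
    have hk' : k < n := by omega
    rw [iter_succ x hk', ih hk'.le]
    -- the kernel equation at position `k`
    have heq := hv ⟨k, hk'⟩
    simp only [prv, nxt] at heq
    unfold tstep
    ext
    · -- first component: `v_k`
      simp only
      congr 1
      exact Fin.ext (by simp [Nat.mod_eq_of_lt hk'])
    · -- second component: `v_{k+1} = v_{k-1} + x_k v_k`
      simp only
      have hkmod : (⟨k % n, Nat.mod_lt _ (by omega)⟩ : Fin n) = ⟨k, hk'⟩ :=
        Fin.ext (by simp [Nat.mod_eq_of_lt hk'])
      rw [hkmod]
      revert heq
      cases v ⟨(k + n - 1) % n, Nat.mod_lt _ (by omega)⟩ <;> cases v ⟨(k + 1) % n, Nat.mod_lt _ (by omega)⟩ <;>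
        cases x ⟨k, hk'⟩ <;> cases v ⟨k, hk'⟩ <;> simp

/-- **`K(x)` ↪ fixed points of the monodromy**: the initial state of a kernel vector is fixed. -/
theorem monodromy_fixed_of_inKernel (hn : 3 ≤ n) {x v : Fin n → Bool} (hv : InKernel x v) :
    monodromy (List.ofFn x) (v ⟨n - 1, by omega⟩, v ⟨0, by omega⟩) =
      (v ⟨n - 1, by omega⟩, v ⟨0, by omega⟩) := by
  rw [← iter_length, iter_eq_of_inKernel hn hv n le_rfl]
  congr 2
  · exact Fin.ext (by simp [Nat.mod_eq_of_lt (show n - 1 < n by omega), show n + n - 1 = (n - 1) + n by omega])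
  · exact Fin.ext (by simp)

/-- A kernel vector is the trajectory of its initial state. -/
theorem eq_kernelVec_of_inKernel (hn : 3 ≤ n) {x v : Fin n → Bool} (hv : InKernel x v) :
    v = kernelVec x (v ⟨n - 1, by omega⟩, v ⟨0, by omega⟩) := by
  funext k
  unfold kernelVec
  rw [iter_eq_of_inKernel hn hv k.val k.isLt.le]
  simp only
  congr 1
  exact Fin.ext (by simp [Nat.mod_eq_of_lt k.isLt])

/-- **Fixed points of the monodromy give kernel vectors**: if `W(x) s = s` then the trajectory
of `s` lies in `K(x)` (`n ≥ 3`). -/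
theorem inKernel_kernelVec (hn : 3 ≤ n) (x : Fin n → Bool) {s : St}
    (hs : monodromy (List.ofFn x) s = s) : InKernel x (kernelVec x s) := by
  -- states along the trajectory: `iter (k+1) = (v_k, v_{k+1})`, with wrap-around from `hs`
  have hwrap : iter x n s = s := by rw [iter_length, hs]
  -- second component one step later: `v_{k+1} = v_{k-1} + x_k v_k` where `(v_{k-1}, v_k) = iter k`
  have hstep : ∀ k (hk : k < n), (iter x (k + 1) s).2 = xor (iter x k s).1 (x ⟨k, hk⟩ && (iter x k s).2) :=
    fun k hk => by rw [iter_succ x hk]; rfl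
  intro b
  obtain ⟨b, hb⟩ := b
  simp only [prv, nxt, kernelVec]
  -- name the three values
  -- case split on the position: `b = 0`, `0 < b < n-1`, `b = n-1`
  have hfst : ∀ k (hk : k < n), (iter x (k + 1) s).1 = (iter x k s).2 := fun k hk => iter_succ_fst x hk s
  by_cases hb0 : b = 0
  · subst hb0
    -- `v_{n-1} = s.1`, `v_0 = s.2`, `v_1 = s.1 + x_0 s.2`
    have hn1 : (0 + n - 1) % n = n - 1 := by
      rw [Nat.zero_add, Nat.mod_eq_of_lt (by omega)]
    have hlast : (iter x (n - 1) s).2 = s.1 := by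
      have := hfst (n - 1) (by omega)
      rw [show n - 1 + 1 = n by omega, hwrap] at this
      exact this.symm
    have h1 : (0 + 1) % n = 1 := Nat.mod_eq_of_lt (by omega)
    simp only [hn1, h1, iter_zero]
    rw [hlast, hstep 0 (by omega), iter_zero]
    cases s.1 <;> cases s.2 <;> cases x ⟨0, hb⟩ <;> rfl
  · by_cases hbl : b = n - 1
    · subst hbl
      have hp : (n - 1 + n - 1) % n = n - 2 := by
        rw [show n - 1 + n - 1 = (n - 2) + n by omega, Nat.add_mod_right, Nat.mod_eq_of_lt (by omega)]
      have hnx : (n - 1 + 1) % n = 0 := by rw [show n - 1 + 1 = n by omega, Nat.mod_self]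
      simp only [hp, hnx, iter_zero]
      -- `v_0 = s.2 = (iter n s).2 = v_{n-2} + x_{n-1} v_{n-1}`
      have h2 : s.2 = xor (iter x (n - 1) s).1 (x ⟨n - 1, hb⟩ && (iter x (n - 1) s).2) := by
        have := hstep (n - 1) hb
        rw [show n - 1 + 1 = n by omega, hwrap] at this
        exact this
      have h3 : (iter x (n - 1) s).1 = (iter x (n - 2) s).2 := by
        have := hfst (n - 2) (by omega)
        rw [show n - 2 + 1 = n - 1 by omega] at this
        exact this
      rw [h2, h3]
      cases (iter x (n - 2) s).2 <;> cases (iter x (n - 1) s).2 <;> cases x ⟨n - 1, hb⟩ <;> rfl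
    · -- interior position
      have hb1 : 0 < b := Nat.pos_of_ne_zero hb0
      have hp : (b + n - 1) % n = b - 1 := by
        rw [show b + n - 1 = (b - 1) + n by omega, Nat.add_mod_right, Nat.mod_eq_of_lt (by omega)]
      have hnx : (b + 1) % n = b + 1 := Nat.mod_eq_of_lt (by omega)
      simp only [hp, hnx]
      rw [hstep b hb]
      have h3 : (iter x b s).1 = (iter x (b - 1) s).2 := by
        have := hfst (b - 1) (by omega)
        rw [show b - 1 + 1 = b by omega] at this
        exact this
      rw [h3]
      cases (iter x (b - 1) s).2 <;> cases (iter x b s).2 <;> cases x ⟨b, hb⟩ <;> rfl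

/-- **`K(x)` = trajectories of fixed states** (`n ≥ 3`). -/
theorem inKernel_iff_fixed (hn : 3 ≤ n) (x v : Fin n → Bool) :
    InKernel x v ↔ ∃ s : St, monodromy (List.ofFn x) s = s ∧ v = kernelVec x s :=
  ⟨fun hv => ⟨_, monodromy_fixed_of_inKernel hn hv, eq_kernelVec_of_inKernel hn hv⟩,
    fun ⟨_, hs, hv⟩ => hv ▸ inKernel_kernelVec hn x hs⟩

/-- The trajectory of the zero state is the zero vector. -/
theorem kernelVec_zero (x : Fin n → Bool) : kernelVec x (false, false) = fun _ => false := by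
  have h : ∀ k, k ≤ n → iter x k (false, false) = (false, false) := by
    intro k
    induction k with
    | zero => intro _; rfl
    | succ k ih =>
      intro hk
      rw [iter_succ x (by omega), ih (by omega)]
      cases x ⟨k, by omega⟩ <;> rfl
  funext k
  unfold kernelVec
  rw [h k.val k.isLt.le]

/-- The trajectory of a nonzero state is a nonzero vector (`n ≥ 3`): `v_0 = s.2`, `v_{n−1} = s.1`
when `s` is fixed. -/
theorem kernelVec_ne_zero (hn : 3 ≤ n) (x : Fin n → Bool) {s : St}
    (hs : monodromy (List.ofFn x) s = s) (hs0 : s ≠ (false, false)) :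
    kernelVec x s ≠ fun _ => false := by
  intro h
  apply hs0
  have h0 : s.2 = false := by
    have := congrFun h ⟨0, by omega⟩
    simpa [kernelVec] using this
  have h1 : s.1 = false := by
    have hl := congrFun h ⟨n - 1, by omega⟩
    simp only [kernelVec] at hl
    have := iter_succ_fst x (show n - 1 < n by omega) s
    rw [show n - 1 + 1 = n by omega, iter_length, hs] at this
    rw [this, hl]
  ext <;> assumption

/-- **Closed form of the trajectory**: the `k`-th coordinate of `kernelVec x s` is read off the
dictionary element of the PREFIX word `x_0 … x_{k−1}` (so `v⋆_k` is an explicit function of the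
prefix zero-parity and the prefix signed count mod `3` — planner qa-qnc0-p2's `SuppWalkLaw` in
dictionary coordinates). -/
theorem kernelVec_eq_dict_prefix (x : Fin n → Bool) (s : St) (k : Fin n) :
    kernelVec x s k =
      (dict (reflBit ((List.ofFn x).take k.val)) (sigmaSum ((List.ofFn x).take k.val)) s).2 := by
  unfold kernelVec iter
  rw [← monodromy_eq_dict]
  rfl

/-! ### The structure theorem -/

/-- The zero vector lies in every ring kernel. -/
theorem inKernel_zero (x : Fin n → Bool) : InKernel x (fun _ => false) := by
  intro b; cases x b <;> rfl

/-- `reflBit` of the word of `x` is the parity of the number of zeros of `x`. -/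
theorem reflBit_ofFn_iff : ∀ {n : ℕ} (x : Fin n → Bool),
    reflBit (List.ofFn x) = true ↔ Odd ((Finset.univ.filter fun i : Fin n => x i = false).card)
  | 0, x => by simp [reflBit]
  | n + 1, x => by
    rw [List.ofFn_succ, reflBit]
    have ih := reflBit_ofFn_iff (fun i : Fin n => x i.succ)
    have hcard : (Finset.univ.filter fun i : Fin (n + 1) => x i = false).card =
        (if x 0 = false then 1 else 0) + (Finset.univ.filter fun i : Fin n => x i.succ = false).card := by
      rw [Finset.card_filter, Finset.card_filter, Fin.sum_univ_succ]
    rw [hcard]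
    by_cases h0 : x 0 = false
    · rw [if_pos h0, h0]
      simp only [Bool.not_false, Bool.xor_true, Bool.not_eq_true']
      rw [add_comm, Nat.odd_add_one, ← ih]
      cases reflBit (List.ofFn fun i : Fin n => x i.succ) <;> simp
    · rw [if_neg h0, zero_add, ← ih]
      rw [Bool.not_eq_false] at h0
      rw [h0]
      simp

/-- **Structure theorem, odd class** (`n ≥ 3`): if `x` has an odd number of zeros, the ring
kernel is the line `K(x) = {0, v⋆(x)}`, `v⋆(x) = kernelVec x (fixVec (sigmaSum x))`
(planner qa-qnc0-p1 K6 (F2), qa-qnc0-p2 §8.2; all `n`). -/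
theorem kernel_odd (hn : 3 ≤ n) (x : Fin n → Bool) (hodd : reflBit (List.ofFn x) = true)
    (v : Fin n → Bool) :
    InKernel x v ↔ v = (fun _ => false) ∨ v = kernelVec x (fixVec (sigmaSum (List.ofFn x))) := by
  have hW : ∀ s, monodromy (List.ofFn x) s = dict true (sigmaSum (List.ofFn x)) s := fun s => by
    rw [monodromy_eq_dict, hodd]
  rw [inKernel_iff_fixed hn]
  constructor
  · rintro ⟨s, hs, rfl⟩
    rw [hW, dict_true_fixed_iff] at hs
    rcases hs with rfl | rfl
    · exact Or.inl (kernelVec_zero x)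
    · exact Or.inr rfl
  · rintro (rfl | rfl)
    · exact ⟨(false, false), by rw [hW, dict_true_fixed_iff]; exact Or.inl rfl, (kernelVec_zero x).symm⟩
    · exact ⟨_, by rw [hW, dict_true_fixed_iff]; exact Or.inr rfl, rfl⟩

/-- The kernel vector of the odd class is nonzero (`n ≥ 3`). -/
theorem kernelVec_fixVec_ne_zero (hn : 3 ≤ n) (x : Fin n → Bool) (hodd : reflBit (List.ofFn x) = true) :
    kernelVec x (fixVec (sigmaSum (List.ofFn x))) ≠ fun _ => false := by
  refine kernelVec_ne_zero hn x ?_ (fixVec_ne_zero _)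
  rw [monodromy_eq_dict, hodd, dict_true_fixed_iff]
  exact Or.inr rfl

/-- **Structure theorem, even class, generic monodromy** (`n ≥ 3`): an even number of zeros and
`sigmaSum x ≠ 0` (monodromy of order `3`) force `K(x) = {0}`. -/
theorem kernel_even_trivial (hn : 3 ≤ n) (x : Fin n → Bool) (heven : reflBit (List.ofFn x) = false)
    (hS : sigmaSum (List.ofFn x) ≠ 0) (v : Fin n → Bool) :
    InKernel x v ↔ v = fun _ => false := by
  rw [inKernel_iff_fixed hn]
  constructor
  · rintro ⟨s, hs, rfl⟩
    rw [monodromy_eq_dict, heven, dict_false_fixed_iff] at hs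
    rcases hs with h | rfl
    · exact absurd h hS
    · exact kernelVec_zero x
  · rintro rfl
    refine ⟨(false, false), ?_, (kernelVec_zero x).symm⟩
    rw [monodromy_eq_dict, heven, dict_false_fixed_iff]
    exact Or.inr rfl

/-- **Structure theorem, even class, trivial monodromy** (`n ≥ 3`): an even number of zeros and
`sigmaSum x = 0` make EVERY state fixed, so `K(x)` consists of the four trajectories
`kernelVec x s` (dimension `2`). -/
theorem kernel_even_full (hn : 3 ≤ n) (x : Fin n → Bool) (heven : reflBit (List.ofFn x) = false)
    (hS : sigmaSum (List.ofFn x) = 0) (v : Fin n → Bool) :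
    InKernel x v ↔ ∃ s : St, v = kernelVec x s := by
  rw [inKernel_iff_fixed hn]
  constructor
  · rintro ⟨s, -, hv⟩; exact ⟨s, hv⟩
  · rintro ⟨s, hv⟩
    refine ⟨s, ?_, hv⟩
    rw [monodromy_eq_dict, heven, dict_false_fixed_iff]
    exact Or.inl hS

end Summit.QuantumAdvantage.AdviceFreeQNC0
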